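import Summits.CriticalPhenomena.PercolationContinuityZ3.Theorems.Transplant.PlanarCells2TDefs
import HarnessLib

/-!
# N2 (frames-only node `SamePDropOfSkeletonFrm₁`, OPEN), Geom foundation under (R-45)/J23: TWO-UNIT STAGGERED PLANAR CELLS WITH PER-AXIS
# **ASYMMETRIC TRANSVERSE ROOMS** `PCells2V` — the J23 successor of `PCells2T` (PlanarCells2TDefs)

RULING J23 (lead g12 2026-08-23T11:06:40Z/11:31:15Z; LOCATED p3-g17 11:05:58Z; sieve p5-g16 11:12:28Z; STEP 0 hp-8 g42 11:29:31Z): in the frames-only node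
every served transverse motion is ONE-SIDED (forward: east x-strides, north y′-hops — Lemma B9), so the face step from a contact in the FORWARD part of a
face row `cenS v ⊥ ± 2r⊥` cannot be steered back into the `±b₀` target about the creep-shifted neighbour centre (`cenS (v+δ) ⊥ = cenS v ⊥ + sgOf δ·c δ.1`);
the cure (C1 PROPER) bounds the habitat's FORWARD transverse room: the slab family `H_{v,x} ⊇ H^j ⊇ F^j`, `Zone` gets the transverse interval
**`σ·[−hB δ.1, hF δ.1]`** (oriented like the creep, `σ := sgOf δ`) in place of the literal `[−2r⊥, 2r⊥]`, with `hB I, hF I ≤ 2·r (oth I)` so that every V set is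
INSIDE its T namesake (and `PCells2T.toV` with `hB = hF := 2r⊥` recovers T verbatim: every landed T theorem is the symmetric instance; nothing is invalidated
or edited).  `Q/M/Cell/Btw/Efar/Ewv/BtwN/EfarN/EwvN/farAN/farAS/lev/probeWorldN` are T's verbatim (re-declared in namespace `PCells2V` so that the token port
`PCells2T.X ↦ PCells2V.X` is total); `cenS` and the whole §1 of PlanarCells2TDefs are INHERITED (`P.cenS = P.toPCells2T.cenS`; use the T lemmas
`cenS_apply/…/cenS_sep` at `P.toPCells2T`).  The value of record (stmt, (R-44)): `hB := 2r⊥`, `hF⊥ := c⊥ + ρ⊥` with p5-g16's feasibility row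
`μ⊥ ≥ oh + W_run + σz − 1` at the window `BSlot.small2 = (48·s₀, 16·s₁)`.  Letter `V` (p5-g16 11:32:07Z: `U` is taken by the (C) union-prism modules).
NON-VACUITY: a structure file; witnesses = `PCells2T.toV` of stmt's `fcellsT` (symmetric instance) and stmt's `fcellsV` to come (`hF⊥ := c⊥ + ρ⊥ ≤ 2r⊥`).
builds on p205010 (kernel theorem, internal audit signed; external expert review pending) — nothing in this file uses p205010; nothing here is a
claim about the open node `SamePDropOfSkeletonFrm₁`.
Lane `prim-bschramm`, seat `prim-hp-8` (gen 42; J23 port owner); helper file (`--supports stmt-CriticalPhenomena-4575 --as helper`); design owner p3-g17 ((R-44)/(R-45)).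
* §1 asymmetric signed boxes `sLoA/sHiA/sBoxA` (`{α ≤ σ(x_a − c_a) ≤ β} × {−wB ≤ σ(x_j − c_j) ≤ wF}`), `mem_sBoxA_iff`, `sBoxA_subset_sBox`, `sBoxA_self : sBoxA … w w = sBox … w`,
  `sBoxA_mono`, `mem_psBoxA_iff` (planar, signed across form — twin of `mem_psBox_iff`), `across_sym_of_signed`;
* §2 `PCells2V` (`PCells2T` + `hB hF : Fin 2 → ℕ`, `hB_le/hF_le : _ ≤ 2·r (oth I)`), `hB_le'/hF_le'` (ℤ casts), `PCells2T.toV` (+ `toV_hB/toV_hF/toV_toPCells2T`);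
* §3 the box family (names of PlanarCells2TDefs §2; slab family asymmetric), `mem_aboxS_iff`, `Icc_faceLo_faceHi`, `cenS_mem`,
  `mem_Stub_iff`, `across_2r_of_signed`, `Stub/Zone/Face/Hfull_subset_T` (each V slab set inside its T namesake at `P.toPCells2T`), `toV_Stub/Zone/Face/Hfull`
  (the symmetric instance is T's set).
[cite: KozmaNitzan2024, §4 pp. 25–26 (Q_v, M_v, E_{v,x}, H^j_{v,x}), p. 30 (F^j_{v,x})]
-/

noncomputable section

namespace Summit.CriticalPhenomena.PercolationContinuityZ3.Theorems

namespace Transplant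

open Literature.Probability.Percolation Literature.Probability.LatticeModels SimpleGraph GadgetSystem Contour
open Literature.Probability.Percolation.KozmaNitzan
open Literature.Probability.Percolation.KozmaNitzan.Cells (oth oth_ne sgOf sgOf_sign stepVec_apply_fst stepVec_apply_oth eq_oth_of_ne oth_oth
  eq_of_coords)
open PCells (mem_psBox_iff)

/-! ## §1 Asymmetric signed boxes -/

/-- Lower corner of the ASYMMETRIC signed box `{α ≤ σ (x_a − c_a) ≤ β} × {−wB ≤ σ (x_j − c_j) ≤ wF}`. [folklore] -/
def sLoA (a : Fin 2) (σ : ℤ) (c : Site 2) (α β wB wF : ℤ) : Site 2 :=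
  fun j => if j = a then (if σ = 1 then c a + α else c a - β) else (if σ = 1 then c j - wB else c j - wF)

/-- Upper corner of the asymmetric signed box. [folklore] -/
def sHiA (a : Fin 2) (σ : ℤ) (c : Site 2) (α β wB wF : ℤ) : Site 2 :=
  fun j => if j = a then (if σ = 1 then c a + β else c a - α) else (if σ = 1 then c j + wF else c j + wB)

/-- **The asymmetric signed box** `{α ≤ σ (x_a − c_a) ≤ β} ∩ {−wB ≤ σ (x_j − c_j) ≤ wF, j ≠ a}`: backward transverse room `wB`, forward room `wF`,
both ORIENTED BY THE SAME SIGN `σ` as the along interval (the creep of a `σ`-step points to `+σ`). [this work] -/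
def sBoxA (a : Fin 2) (σ : ℤ) (c : Site 2) (α β wB wF : ℤ) : Finset (Site 2) :=
  Finset.Icc (sLoA a σ c α β wB wF) (sHiA a σ c α β wB wF)

/-- Membership in an asymmetric signed box. [folklore] -/
theorem mem_sBoxA_iff {a : Fin 2} {σ : ℤ} (hσ : σ = 1 ∨ σ = -1) {c : Site 2} {α β wB wF : ℤ} {x : Site 2} :
    x ∈ sBoxA a σ c α β wB wF ↔
      (α ≤ σ * (x a - c a) ∧ σ * (x a - c a) ≤ β) ∧ ∀ j, j ≠ a → -wB ≤ σ * (x j - c j) ∧ σ * (x j - c j) ≤ wF := by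
  rw [sBoxA, Finset.mem_Icc]
  constructor
  · intro h
    refine ⟨?_, fun j hj => ?_⟩
    · have h1 := h.1 a
      have h2 := h.2 a
      simp only [sLoA, sHiA, if_true] at h1 h2
      rcases hσ with rfl | rfl
      · simp only [if_true] at h1 h2; omega
      · simp only [show (-1 : ℤ) ≠ 1 by norm_num, if_false] at h1 h2; omega
    · have h1 := h.1 j
      have h2 := h.2 j
      simp only [sLoA, sHiA, if_neg hj] at h1 h2
      rcases hσ with rfl | rfl
      · simp only [if_true] at h1 h2; omega
      · simp only [show (-1 : ℤ) ≠ 1 by norm_num, if_false] at h1 h2; omega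
  · rintro ⟨ha, hj⟩
    constructor <;> intro i
    all_goals
      by_cases hi : i = a
      · subst hi
        simp only [sLoA, sHiA, if_true]
        rcases hσ with rfl | rfl
        · simp only [if_true]; omega
        · simp only [show (-1 : ℤ) ≠ 1 by norm_num, if_false]; omega
      · have := hj i hi
        simp only [sLoA, sHiA, if_neg hi]
        rcases hσ with rfl | rfl
        · simp only [if_true]; omega
        · simp only [show (-1 : ℤ) ≠ 1 by norm_num, if_false]; omega

/-- **An asymmetric signed box sits inside the symmetric one of any larger half-width.** [folklore] -/
theorem sBoxA_subset_sBox {a : Fin 2} {σ : ℤ} (hσ : σ = 1 ∨ σ = -1) (c : Site 2) (α β : ℤ) {wB wF w : ℤ} (hB : wB ≤ w) (hF : wF ≤ w) :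
    sBoxA a σ c α β wB wF ⊆ sBox a σ c α β w := by
  intro x hx
  rw [mem_sBoxA_iff hσ] at hx
  rw [mem_sBox_iff hσ]
  refine ⟨hx.1, fun j hj => ?_⟩
  have := hx.2 j hj
  rcases hσ with rfl | rfl <;> constructor <;> nlinarith [this.1, this.2]

/-- The asymmetric box with equal rooms is the symmetric signed box. [folklore] -/
theorem sBoxA_self {a : Fin 2} {σ : ℤ} (hσ : σ = 1 ∨ σ = -1) (c : Site 2) (α β w : ℤ) : sBoxA a σ c α β w w = sBox a σ c α β w := by
  ext x
  rw [mem_sBoxA_iff hσ, mem_sBox_iff hσ]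
  refine and_congr Iff.rfl (forall_congr' fun j => imp_congr_right fun _ => ?_)
  rcases hσ with rfl | rfl <;> constructor <;> rintro ⟨h1, h2⟩ <;> constructor <;> linarith


/-- Monotonicity of asymmetric signed boxes in their parameters. [folklore] -/
theorem sBoxA_mono {a : Fin 2} {σ : ℤ} (hσ : σ = 1 ∨ σ = -1) (c : Site 2) {α β wB wF α' β' wB' wF' : ℤ}
    (hα : α' ≤ α) (hβ : β ≤ β') (hB : wB ≤ wB') (hF : wF ≤ wF') : sBoxA a σ c α β wB wF ⊆ sBoxA a σ c α' β' wB' wF' := by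
  intro x hx
  rw [mem_sBoxA_iff hσ] at hx ⊢
  refine ⟨⟨hα.trans hx.1.1, hx.1.2.trans hβ⟩, fun j hj => ?_⟩
  have := hx.2 j hj
  constructor <;> linarith [this.1, this.2]

/-- Membership in a planar asymmetric signed box of a direction `δ`, across bounds in the SIGNED form `−wB ≤ σ (t⊥ − c⊥) ≤ wF` (twin of `mem_psBox_iff`).
[folklore] -/
theorem mem_psBoxA_iff {δ : MDir} {c : Site 2} {α β wB wF : ℤ} {t : Site 2} :
    t ∈ sBoxA δ.1 (sgOf δ) c α β wB wF ↔ (α ≤ sgOf δ * (t δ.1 - c δ.1) ∧ sgOf δ * (t δ.1 - c δ.1) ≤ β) ∧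
      (-wB ≤ sgOf δ * (t (oth δ.1) - c (oth δ.1)) ∧ sgOf δ * (t (oth δ.1) - c (oth δ.1)) ≤ wF) := by
  rw [mem_sBoxA_iff (sgOf_sign δ)]
  refine and_congr_right fun _ => ⟨fun h => h _ (oth_ne δ.1), fun h j hj => ?_⟩
  rw [eq_oth_of_ne hj]; exact h

/-- From the signed across bounds to KN's symmetric ones: `−wB ≤ σ (t⊥ − c⊥) ≤ wF` with `wB, wF ≤ w` gives `c⊥ − w ≤ t⊥ ≤ c⊥ + w`. [folklore] -/
theorem across_sym_of_signed {σ : ℤ} (hσ : σ = 1 ∨ σ = -1) {u c wB wF w : ℤ} (h1 : -wB ≤ σ * (u - c)) (h2 : σ * (u - c) ≤ wF)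
    (hB : wB ≤ w) (hF : wF ≤ w) : c - w ≤ u ∧ u ≤ c + w := by
  rcases hσ with rfl | rfl <;> constructor <;> linarith

/-! ## §2 Staggered cells with asymmetric transverse rooms -/

/-- **Two-unit staggered planar cells with per-axis ASYMMETRIC transverse rooms** ((R-45)/J23): `PCells2T` plus, for steps along axis `I`, the backward and
forward transverse half-widths `hB I, hF I ≤ 2·r (oth I)` of the slab family (oriented like the creep `c I`). [this work] -/
structure PCells2V extends PCells2T where
  /-- backward transverse room of the slab family of a step along axis `I` (against the creep) -/
  hB : Fin 2 → ℕ
  /-- forward transverse room of the slab family of a step along axis `I` (with the creep) -/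
  hF : Fin 2 → ℕ
  /-- the backward room is at most KN's `2r⊥` -/
  hB_le : ∀ I, hB I ≤ 2 * toPCells2T.r (oth I)
  /-- the forward room is at most KN's `2r⊥` -/
  hF_le : ∀ I, hF I ≤ 2 * toPCells2T.r (oth I)

namespace PCells2V

/-- `hB I ≤ 2·r⊥` in `ℤ`. [folklore] -/
theorem hB_le' (P : PCells2V) (I : Fin 2) : (P.hB I : ℤ) ≤ 2 * (P.r (oth I) : ℤ) := by exact_mod_cast P.hB_le I

/-- `hF I ≤ 2·r⊥` in `ℤ`. [folklore] -/
theorem hF_le' (P : PCells2V) (I : Fin 2) : (P.hF I : ℤ) ≤ 2 * (P.r (oth I) : ℤ) := by exact_mod_cast P.hF_le I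

end PCells2V

/-- **KN's symmetric rooms are asymmetric rooms** (`hB = hF := 2r⊥`): every `PCells2T` is a `PCells2V`. [folklore] -/
def PCells2T.toV (P : PCells2T) : PCells2V where
  toPCells2T := P
  hB := fun I => 2 * P.r (oth I)
  hF := fun I => 2 * P.r (oth I)
  hB_le := fun _ => le_rfl
  hF_le := fun _ => le_rfl

/-- `toV` keeps the T data. [folklore] -/
@[simp] theorem PCells2T.toV_toPCells2T (P : PCells2T) : P.toV.toPCells2T = P := rfl

/-- `toV`'s backward room. [folklore] -/
@[simp] theorem PCells2T.toV_hB (P : PCells2T) (I : Fin 2) : P.toV.hB I = 2 * P.r (oth I) := rfl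

/-- `toV`'s forward room. [folklore] -/
@[simp] theorem PCells2T.toV_hF (P : PCells2T) (I : Fin 2) : P.toV.hF I = 2 * P.r (oth I) := rfl

namespace PCells2V

/-! ## §3 The boxes about the staggered centre (`PlanarCells2TDefs` §2 verbatim, EXCEPT the slab family `Stub/Zone/Face/Hfull/faceLo/faceHi`, whose transverse
room is the asymmetric `σ·[−hB∥, hF∥]`) -/

/-- `Q_v = cenS v + [−5r₀, 5r₀] × [−5r₁, 5r₁]`. [cite: KozmaNitzan2024, §4 p. 26 (Q_v)] -/
def Q (P : PCells2V) (v : Site 2) : Finset (Site 2) := Finset.Icc (P.cenS v - P.hw 5) (P.cenS v + P.hw 5)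

/-- `M_v = cenS v + [−3r₀, 3r₀] × [−3r₁, 3r₁]` (KN's cube; the (C) corridor's ARRIVAL box is the smaller parking box of the scheme, slots `bα, bβ`). [cite: KozmaNitzan2024, §4 p. 26 (M_v)] -/
def M (P : PCells2V) (v : Site 2) : Finset (Site 2) := Finset.Icc (P.cenS v - P.hw 3) (P.cenS v + P.hw 3)

/-- The cell `cenS v + [−10r₀, 10r₀] × [−10r₁, 10r₁]` (diagonal neighbours may share a `c 1 × c 0` corner — see the module docstring). [folklore] -/
def Cell (P : PCells2V) (v : Site 2) : Finset (Site 2) := Finset.Icc (P.cenS v - P.hw 10) (P.cenS v + P.hw 10)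

/-- The between-box `cenS v + {5r∥ < σ x_a < 15r∥} × [−5r⊥, 5r⊥]`. [cite: KozmaNitzan2024, §4 p. 26 (E_{v,x})] -/
def Btw (P : PCells2V) (v : Site 2) (δ : MDir) : Finset (Site 2) :=
  sBox δ.1 (sgOf δ) (P.cenS v) (5 * P.r δ.1 + 1) (15 * P.r δ.1 - 1) (5 * P.r (oth δ.1))

/-- `E^far_{v,x} = cenS v + {5r∥ < σ x_a ≤ 25r∥} × [−5r⊥, 5r⊥]`. [cite: KozmaNitzan2024, §4 p. 26 (E_{v,x})] -/
def Efar (P : PCells2V) (v : Site 2) (δ : MDir) : Finset (Site 2) :=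
  sBox δ.1 (sgOf δ) (P.cenS v) (5 * P.r δ.1 + 1) (25 * P.r δ.1) (5 * P.r (oth δ.1))

/-- `E_{v,x} = Btw ∪ Q_x` (the target's `Q` about the STAGGERED neighbour centre). [cite: KozmaNitzan2024, §4 p. 26 (E_{v,x})] -/
def Ewv (P : PCells2V) (v : Site 2) (δ : MDir) : Finset (Site 2) := P.Btw v δ ∪ P.Q (v + stepVec δ)

/-- The stub `H^j_{v,x} = cenS v + {5r∥ ≤ σ x_a ≤ 5r∥ + 10 s∥ j} × σ·[−hB∥, hF∥]` (ASYMMETRIC transverse rooms, (R-45)). [cite: KozmaNitzan2024, §4 p. 26 (H^j_{v,x})] -/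
def Stub (P : PCells2V) (v : Site 2) (δ : MDir) (j : ℕ) : Finset (Site 2) :=
  sBoxA δ.1 (sgOf δ) (P.cenS v) (5 * P.r δ.1) (5 * P.r δ.1 + 10 * P.s δ.1 * j) (P.hB δ.1) (P.hF δ.1)

/-- The stub zone `cenS v + {10r∥ ≤ σ x_a ≤ 15r∥ − 10s∥} × σ·[−hB∥, hF∥]` ((R-45)). [cite: KozmaNitzan2024, §4 p. 26] -/
def Zone (P : PCells2V) (v : Site 2) (δ : MDir) : Finset (Site 2) :=
  sBoxA δ.1 (sgOf δ) (P.cenS v) (10 * P.r δ.1) (15 * P.r δ.1 - 10 * P.s δ.1) (P.hB δ.1) (P.hF δ.1)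

/-- The face `F^j_{v,x} = cenS v + {σ x_a = 5r∥ + 10s∥j} × σ·[−hB∥, hF∥]` ((R-45)). [cite: KozmaNitzan2024, §4 p. 30 (F^j_{v,x})] -/
def Face (P : PCells2V) (v : Site 2) (δ : MDir) (j : ℕ) : Finset (Site 2) :=
  sBoxA δ.1 (sgOf δ) (P.cenS v) (5 * P.r δ.1 + 10 * P.s δ.1 * j) (5 * P.r δ.1 + 10 * P.s δ.1 * j) (P.hB δ.1) (P.hF δ.1)

/-- The full corridor `H_{v,x} = cenS v + {5r∥ ≤ σ x_a ≤ 22r∥} × σ·[−hB∥, hF∥]` ((R-45)). [cite: KozmaNitzan2024, §4 p. 26 (H_{v,x})] -/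
def Hfull (P : PCells2V) (v : Site 2) (δ : MDir) : Finset (Site 2) :=
  sBoxA δ.1 (sgOf δ) (P.cenS v) (5 * P.r δ.1) (22 * P.r δ.1) (P.hB δ.1) (P.hF δ.1)

/-- The narrow between-box `cenS v + {5r∥ < σ x_a < 15r∥} × [−(5r⊥−1), 5r⊥−1]`. [cite: KozmaNitzan2024, §4 p. 26 (E_{v,x})] -/
def BtwN (P : PCells2V) (v : Site 2) (δ : MDir) : Finset (Site 2) :=
  sBox δ.1 (sgOf δ) (P.cenS v) (5 * P.r δ.1 + 1) (15 * P.r δ.1 - 1) (5 * P.r (oth δ.1) - 1)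

/-- The narrow far region `cenS v + {5r∥ < σ x_a ≤ 25r∥} × [−(5r⊥−1), 5r⊥−1]`. [cite: KozmaNitzan2024, §4 p. 26 (E_{v,x})] -/
def EfarN (P : PCells2V) (v : Site 2) (δ : MDir) : Finset (Site 2) :=
  sBox δ.1 (sgOf δ) (P.cenS v) (5 * P.r δ.1 + 1) (25 * P.r δ.1) (5 * P.r (oth δ.1) - 1)

/-- The narrow `E_{v,x} = BtwN ∪ Q_x`. [cite: KozmaNitzan2024, §4 p. 26 (E_{v,x})] -/
def EwvN (P : PCells2V) (v : Site 2) (δ : MDir) : Finset (Site 2) := P.BtwN v δ ∪ P.Q (v + stepVec δ)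

/-- The narrow fresh rows above the stub of level `j`. [cite: KozmaNitzan2024, §4 p. 30] -/
def farAN (P : PCells2V) (x : Site 2) (du : MDir) (j : ℕ) : Finset (Site 2) :=
  sBox du.1 (sgOf du) (P.cenS x) (5 * P.r du.1 + 10 * P.s du.1 * j + 1) (25 * P.r du.1) (5 * P.r (oth du.1) - 1)

/-- The shrunk far rows (one unit inside `farAN` on every side). [cite: KozmaNitzan2024, §4 p. 30 (the rows above H^j)] -/
def farAS (P : PCells2V) (x : Site 2) (du : MDir) (j : ℕ) : Finset (Site 2) :=
  sBox du.1 (sgOf du) (P.cenS x) (5 * P.r du.1 + 10 * P.s du.1 * j + 2) (25 * P.r du.1 - 1) (5 * P.r (oth du.1) - 2)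

/-- The level of `t` along `δ` from `v`: `σ (t_a − cenS v_a)`. [cite: KozmaNitzan2024, §4 p. 30] -/
def lev (P : PCells2V) (δ : MDir) (v : Site 2) (t : Site 2) : ℤ := sgOf δ * (t δ.1 - P.cenS v δ.1)

/-- Lower corner of the shifted face row about the staggered centre (asymmetric room). [folklore] -/
def faceLo (P : PCells2V) (x : Site 2) (du : MDir) (j : ℕ) : Site 2 :=
  sLoA du.1 (sgOf du) (P.cenS x) (P.faceL du.1 j) (P.faceL du.1 j) (P.hB du.1) (P.hF du.1)

/-- Upper corner of the shifted face row about the staggered centre (asymmetric room). [folklore] -/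
def faceHi (P : PCells2V) (x : Site 2) (du : MDir) (j : ℕ) : Site 2 :=
  sHiA du.1 (sgOf du) (P.cenS x) (P.faceL du.1 j) (P.faceL du.1 j) (P.hB du.1) (P.hF du.1)

/-- The narrow planar world of the probe `v → v+δ → v+δ+du` about staggered centres (the target's cube and corridor move with the staggered
neighbour `v + δ`). [cite: KozmaNitzan2024, §4 p. 26 (E_{v,x}, H_{x,y})] -/
def probeWorldN (P : PCells2V) (v : Site 2) (δ du : MDir) : Finset (Site 2) := P.BtwN v δ ∪ P.Q (v + stepVec δ) ∪ P.Hfull (v + stepVec δ) du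

/-! ### Membership -/

/-- Membership in a staggered-centred anisotropic box of half-widths `(n r₀, n r₁)`. [folklore] -/
theorem mem_aboxS_iff (P : PCells2V) {v : Site 2} {n : ℕ} {t : Site 2} :
    t ∈ Finset.Icc (P.cenS v - P.hw n) (P.cenS v + P.hw n) ↔ ∀ i, P.cenS v i - (n * P.r i : ℕ) ≤ t i ∧ t i ≤ P.cenS v i + (n * P.r i : ℕ) := by
  rw [mem_Icc_iff]
  refine forall_congr' fun i => ?_
  simp only [Pi.sub_apply, Pi.add_apply, PCells2.hw_apply]

/-- The shifted face row about the staggered centre as a signed box. [folklore] -/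
theorem Icc_faceLo_faceHi (P : PCells2V) (x : Site 2) (du : MDir) (j : ℕ) :
    Finset.Icc (P.faceLo x du j) (P.faceHi x du j) = sBoxA du.1 (sgOf du) (P.cenS x) (P.faceL du.1 j) (P.faceL du.1 j) (P.hB du.1) (P.hF du.1) := rfl

/-- The centre lies in its own `Q`, `M` and `Cell`. [folklore] -/
theorem cenS_mem (P : PCells2V) (v : Site 2) : P.cenS v ∈ P.Q v ∧ P.cenS v ∈ P.M v ∧ P.cenS v ∈ P.Cell v := by
  simp only [Q, M, Cell, mem_aboxS_iff]
  refine ⟨fun i => ⟨?_, ?_⟩, fun i => ⟨?_, ?_⟩, fun i => ⟨?_, ?_⟩⟩ <;> simp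




/-- Membership in the V stub (signed across form). [folklore] -/
theorem mem_Stub_iff (P : PCells2V) {v : Site 2} {δ : MDir} {j : ℕ} {t : Site 2} :
    t ∈ P.Stub v δ j ↔ ((5 * P.r δ.1 : ℕ) ≤ sgOf δ * (t δ.1 - P.cenS v δ.1) ∧ sgOf δ * (t δ.1 - P.cenS v δ.1) ≤ (5 * P.r δ.1 + 10 * P.s δ.1 * j : ℕ)) ∧
      (-(P.hB δ.1 : ℤ) ≤ sgOf δ * (t (oth δ.1) - P.cenS v (oth δ.1)) ∧ sgOf δ * (t (oth δ.1) - P.cenS v (oth δ.1)) ≤ P.hF δ.1) := by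
  unfold Stub; exact mem_psBoxA_iff

/-- The V slab family's across bounds imply KN's symmetric `±2r⊥` bounds. [folklore] -/
theorem across_2r_of_signed (P : PCells2V) {δ : MDir} {u c0 : ℤ} (h1 : -(P.hB δ.1 : ℤ) ≤ sgOf δ * (u - c0)) (h2 : sgOf δ * (u - c0) ≤ P.hF δ.1) :
    c0 - 2 * (P.r (oth δ.1) : ℤ) ≤ u ∧ u ≤ c0 + 2 * (P.r (oth δ.1) : ℤ) :=
  across_sym_of_signed (sgOf_sign δ) h1 h2 (P.hB_le' δ.1) (P.hF_le' δ.1)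

/-! ### The V slab family inside the T one; the symmetric instance -/

/-- `Stub` (V) ⊆ `Stub` (T). [folklore] -/
theorem Stub_subset_T (P : PCells2V) (v : Site 2) (δ : MDir) (j : ℕ) : P.Stub v δ j ⊆ P.toPCells2T.Stub v δ j :=
  sBoxA_subset_sBox (sgOf_sign δ) _ _ _ (P.hB_le' δ.1) (P.hF_le' δ.1)

/-- `Zone` (V) ⊆ `Zone` (T). [folklore] -/
theorem Zone_subset_T (P : PCells2V) (v : Site 2) (δ : MDir) : P.Zone v δ ⊆ P.toPCells2T.Zone v δ :=
  sBoxA_subset_sBox (sgOf_sign δ) _ _ _ (P.hB_le' δ.1) (P.hF_le' δ.1)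

/-- `Face` (V) ⊆ `Face` (T). [folklore] -/
theorem Face_subset_T (P : PCells2V) (v : Site 2) (δ : MDir) (j : ℕ) : P.Face v δ j ⊆ P.toPCells2T.Face v δ j :=
  sBoxA_subset_sBox (sgOf_sign δ) _ _ _ (P.hB_le' δ.1) (P.hF_le' δ.1)

/-- `Hfull` (V) ⊆ `Hfull` (T). [folklore] -/
theorem Hfull_subset_T (P : PCells2V) (v : Site 2) (δ : MDir) : P.Hfull v δ ⊆ P.toPCells2T.Hfull v δ :=
  sBoxA_subset_sBox (sgOf_sign δ) _ _ _ (P.hB_le' δ.1) (P.hF_le' δ.1)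

/-- The symmetric instance: `toV`'s stub is T's stub. [folklore] -/
theorem toV_Stub (P : PCells2T) (v : Site 2) (δ : MDir) (j : ℕ) : P.toV.Stub v δ j = P.Stub v δ j := by
  unfold Stub PCells2T.Stub
  simp only [PCells2T.toV_hB, PCells2T.toV_hF, PCells2T.toV_toPCells2T]
  push_cast
  exact sBoxA_self (sgOf_sign δ) _ _ _ _

/-- The symmetric instance: `toV`'s zone is T's zone. [folklore] -/
theorem toV_Zone (P : PCells2T) (v : Site 2) (δ : MDir) : P.toV.Zone v δ = P.Zone v δ := by
  unfold Zone PCells2T.Zone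
  simp only [PCells2T.toV_hB, PCells2T.toV_hF, PCells2T.toV_toPCells2T]
  push_cast
  exact sBoxA_self (sgOf_sign δ) _ _ _ _

/-- The symmetric instance: `toV`'s face is T's face. [folklore] -/
theorem toV_Face (P : PCells2T) (v : Site 2) (δ : MDir) (j : ℕ) : P.toV.Face v δ j = P.Face v δ j := by
  unfold Face PCells2T.Face
  simp only [PCells2T.toV_hB, PCells2T.toV_hF, PCells2T.toV_toPCells2T]
  push_cast
  exact sBoxA_self (sgOf_sign δ) _ _ _ _

/-- The symmetric instance: `toV`'s full corridor is T's. [folklore] -/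
theorem toV_Hfull (P : PCells2T) (v : Site 2) (δ : MDir) : P.toV.Hfull v δ = P.Hfull v δ := by
  unfold Hfull PCells2T.Hfull
  simp only [PCells2T.toV_hB, PCells2T.toV_hF, PCells2T.toV_toPCells2T]
  push_cast
  exact sBoxA_self (sgOf_sign δ) _ _ _ _

end PCells2V

/-! ## §4 Enlarging asymmetric signed boxes (appended, hp-8 g42 J23 port: the face-row enlargement lemmas of LevelsV/FaceRowsV) -/

/-- Lower corner of the `R`-enlarged asymmetric signed box. [folklore] -/
theorem sLoA_sub (a : Fin 2) (σ : ℤ) (hσ : σ = 1 ∨ σ = -1) (c : Site 2) (α β wB wF : ℤ) (R : ℕ) :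
    sLoA a σ c α β wB wF - (R : Site 2) = sLoA a σ c (α - R) (β + R) (wB + R) (wF + R) := by
  funext j
  simp only [Pi.sub_apply, sLoA]
  have hR : ((R : Site 2) j) = (R : ℤ) := rfl
  rw [hR]
  by_cases hj : j = a
  · simp only [hj, if_true]; rcases hσ with rfl | rfl <;> simp <;> ring
  · simp only [if_neg hj]; rcases hσ with rfl | rfl <;> simp <;> ring

/-- Upper corner of the `R`-enlarged asymmetric signed box. [folklore] -/
theorem sHiA_add (a : Fin 2) (σ : ℤ) (hσ : σ = 1 ∨ σ = -1) (c : Site 2) (α β wB wF : ℤ) (R : ℕ) :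
    sHiA a σ c α β wB wF + (R : Site 2) = sHiA a σ c (α - R) (β + R) (wB + R) (wF + R) := by
  funext j
  simp only [Pi.add_apply, sHiA]
  have hR : ((R : Site 2) j) = (R : ℤ) := rfl
  rw [hR]
  by_cases hj : j = a
  · simp only [hj, if_true]; rcases hσ with rfl | rfl <;> simp <;> ring
  · simp only [if_neg hj]; rcases hσ with rfl | rfl <;> simp <;> ring

/-- **Enlarging an asymmetric signed box** by `R` in every coordinate (twin of `sBox_enlarge`). [folklore] -/
theorem sBoxA_enlarge (a : Fin 2) (σ : ℤ) (hσ : σ = 1 ∨ σ = -1) (c : Site 2) (α β wB wF : ℤ) (R : ℕ) :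
    Finset.Icc (sLoA a σ c α β wB wF - (R : Site 2)) (sHiA a σ c α β wB wF + (R : Site 2)) =
      sBoxA a σ c (α - R) (β + R) (wB + R) (wF + R) := by
  rw [sLoA_sub a σ hσ, sHiA_add a σ hσ]; rfl

end Transplant

end Summit.CriticalPhenomena.PercolationContinuityZ3.Theorems

end
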